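import Literature.AlgebraicGeometry.Hu2025.Statements.S06WpEllBlowups.R108aWpEllChart
import HarnessLib

/-!
# Hu 2025 (arXiv:2507.21400v1), §6.3 Prop. 6.11 — the RANGE condition «𝔩_𝔙 ⊂ L_{𝔉,[k]}» of the labels clause
# (C47L77 with C47L59; p.107), file d = `S06WpEllBlowups/R108dProp611EllRange.lean` of lit/PARTITION-HU.md row 108 —
# typed by res-type-081 (typer of record, M-Hu-min OPEN line 2026-08-27T08:00:07Z) as the follow-up to lane-B NIT N108a-1
# (res-ref-b12 2026-08-27T08:10:21Z on file a p512346: «the printed 𝔩_𝔙 ⊂ L_{𝔉,[k]} (j ∈ [k], C47L77) is not enforced on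
# WpEllChart.ell : Finset ιF — please carry it as a hypothesis»). Companion of files a/b/c (`R108aWpEllChart` p512346,
# `R108bProp611Items` p515180, `R108cEquationsWpEll` p512654); imports a only.

**STATUS OF THE SOURCE (D-0012 / D-0089): UNREFEREED PREPRINT UNDER ADJUDICATION** — [Hu2025] arXiv:2507.21400v1,
`paper:arxiv-2507.21400`, locators `C<cc>L<l>` (TeX chunk + line) + PDF page. The statement below is a `def … : Prop`
CANDIDATE tagged `[claim: Hu2025, status: under-review]` — «STATUS: candidate statement under adjudication (D-0012/D-0089);
not asserted»; nothing is proved, nothing is asserted, no declaration takes a side. AI typing, weaker than expert review.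

Why a separate decl: the carrier record `WpEllChart` (file a) indexes the 𝔩-labels by the type `ιF` of ALL blocks
`F̄ ∈ 𝔉` (so that the same record serves every stage `(kτ)μh`), while the printed frame restricts the 𝔩-exceptional labels
of a chart of `ℛ̃_{(℘_(kτ)𝔯_μ𝔰_h)}` to `L_{𝔉,[k]} = {L_{F_j} ∣ j ∈ [k]}` (C47L59). The stage's block set `{F_j ∣ j ∈ [k]}` is
the explicit parameter `blocks : Finset ιF` — the SAME parameter as in `Prop6_11_9a` / `Prop6_11_9b` / `IsPreferred` of
file b — and the range condition is typed as one more (◇)-clause Prop over the chart, in the shape of the other clauses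
(`IsAdmissible C → …`). Consumers (J4 / HU-R03 readers of `Prop6_11_lV`) take it as a hypothesis next to `Prop6_11_labels`.
-/

noncomputable section

namespace Literature.AlgebraicGeometry.Hu2025.Statements.S06WpEllBlowups

universe u₁ u₂ u₃ u₄ w

variable {ι₁ : Type u₁} {ι₂ : Type u₂} {ιF : Type u₃} {ιE : Type u₄} {A : Type w} [CommRing A]

/-- **Prop. 6.11, (◇) labels clause, the RANGE of the 𝔩-labels (C47L72–L77 with C47L59; p.106–107).** «The smooth
admissible affine chart 𝔙 of ℛ̃_{(℘_(kτ)𝔯_μ𝔰_h)} comes equipped with a subset 𝔢_𝔙 ⊂ 𝕀⋆_{3,n}, a subset 𝔡_𝔙 ⊂ Λ⋆_𝔉,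
and a subset 𝔩_𝔙 ⊂ L_{𝔉,[k]}», where «L_{𝔉,[k]} = {L_{F_j} ∣ j ∈ [k]}» (C47L59). The first two ranges hold by typing
(`eps : Finset ι₁` with `ι₁ = 𝕀⋆_{3,n}`, `del : Finset ι₂` with `ι₂ = Λ⋆_𝔉`); the third is typed here: the set of blocks
`F` with `L_F ∈ 𝔩_𝔙` (`WpEllChart.ell` = `Prop6_11_lV`) is contained in the stage's block set `blocks = {F_j ∣ j ∈ [k]}`
(explicit parameter, as in `Prop6_11_9a` / `Prop6_11_9b`). Lane-B NIT N108a-1 (res-ref-b12, on file a p512346).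
[claim: Hu2025, status: under-review]
STATUS: candidate statement under adjudication (D-0012/D-0089); not asserted. -/
def Prop6_11_ellRange (blocks : Finset ιF) (C : WpEllChart ι₁ ι₂ ιF ιE A) : Prop :=
  IsAdmissible C → C.ell ⊆ blocks

/-- Anchor alias of `Prop6_11_ellRange` by chunk + line (C47L77 «and a subset 𝔩_𝔙 ⊂ L_{𝔉,[k]}»; p.107).
[claim: Hu2025, status: under-review]
STATUS: candidate statement under adjudication (D-0012/D-0089); not asserted. -/
abbrev C47L77 (blocks : Finset ιF) (C : WpEllChart ι₁ ι₂ ιF ιE A) : Prop := Prop6_11_ellRange blocks C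

end Literature.AlgebraicGeometry.Hu2025.Statements.S06WpEllBlowups

end
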